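import Literature.MathematicalPhysics.QuantumFieldTheory.Balaban1983to89.B9Ineq349SiteThresholdRate

/-!
# `Balaban1983to89.B9Ineq349SiteThresholdRateNamed` — T. Bałaban, *Propagators for lattice gauge theories in a background field*, Commun. Math. Phys. **99** (1985)
# 389–434 [Balaban1985BackgroundPropagators], (3.49) p. 399 («using again Lemma 2.1»): THE (3.49) THRESHOLD FACT AT THE CLOSED RATE WITH ITS THRESHOLD AND
# ITS GEOMETRIC CONSTANT **NAMED** — `thrM349 … δ₀ δ₁`, `cg349 … δ₀ δ₁` — instead of ∃-hidden

[4] = T. Bałaban, *Propagators and renormalization transformations for lattice gauge theories. II*, Commun. Math. Phys. **96** (1984) 223–250 [`Balaban1984PropagatorsII`].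

statement-level skeleton of published theorems with citation tags; proofs where landed; nothing here is a claim about the Yang–Mills mass gap

WHY (cell `pub-ymgap`, node N06, seat `pub-ymgap-dag-n06-d` gen 15).  dag-n06-i's `B9Ineq349SiteThresholdRate.exists_threshold_349_rate` gives, for rates
`δ₀, δ₁ > 0`, `∃ M₃ Cg > 0, ∀ i, M₃ ≤ L·M_h → …, fineEntryS … ≤ B₀·B₁·B₀·Cg·[…]ₙ·(L^{j′}η)^{−d′}·e^{−(min(δ₀,δ₁)∕8) d}`.  The stage-11 certificate DERIVES its
(3.49) majorant `h49` from this fact (`N06Proj349AtPinsPhysR`), and the (3.49) constant `C_P = (d+1)·c_b·b_b·N₁·(B₀·B₁′·B₀·Cg)·e^{2θ}` enters DISPLAYED budgets of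
later letters (dag-n06-l's `hWE_of_pins ∕ hletters13_of_pins`: `hBx`, `hB₃w`).  A budget can only be displayed if every constant in it is a closed term; `Cg` was the
last ∃-bound one.  THIS FILE names the two witnesses by `Classical.choose` behind a `dite` on `0 < δ₀ ∧ 0 < δ₁` (so the names are total functions of
`d, ℓ, b₀, b₁, δ₀, δ₁`, positive UNCONDITIONALLY), and restates the fact at the names — the pattern of `B9GeoNbrCountKLevelV1.nbrM₀Y ∕ nbrCountY` and
`B9WalkLettersCoordsS.walkCntM₀Y ∕ nearBlkCntY`.
* `thrM349 d ℓ hd hL b₀ b₁ δ₀ δ₁ : ℝ` — the `M`-threshold (else-branch `1`); `thrM349_pos`.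
* `cg349 d ℓ hd hL b₀ b₁ δ₀ δ₁ : ℝ` — the geometric constant `C_g` (else-branch `1`); `cg349_pos`.
* ★★ `fineEntryS_le_named` — `exists_threshold_349_rate` at the names: for `0 < δ₀`, `0 < δ₁`, every index `i` with `thrM349 … ≤ L·M_h`, every fibre, all
  `parS Gp U`, `B₀ B₁ ≥ 0`, the three schemas imply the printed entry bounds with constant `B₀·B₁·B₀·cg349 …` and rate `min(δ₀,δ₁)∕8`.
HONEST FRAMING.  0 `sorry`; two `def`s by `choose` (opaque values — only the spec theorem is to be used); nothing of [B9] asserted beyond dag-n06-i's landed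
theorem; one finite 𝕋⁴ programme at fixed `ε` — NOT continuum ∕ OS ∕ mass gap ∕ Clay.
-/

namespace Literature.MathematicalPhysics.QuantumFieldTheory.Balaban1983to89.B9Ineq349SiteThresholdRateNamed

open Literature.MathematicalPhysics.QuantumFieldTheory.Balaban1983to89.Node00 (SiteParY SiteOpY CfgY BlkY P349Y)
open Literature.MathematicalPhysics.QuantumFieldTheory.Balaban1983to89.B6KLevelCensusIndexV1 (KIdx)
open Literature.MathematicalPhysics.QuantumFieldTheory.Balaban1983to89.B9Ineq349SiteReading (fineEntryS)
open Literature.MathematicalPhysics.QuantumFieldTheory.Balaban1983to89.B9Ineq349SiteComposite (lenB distB Left342At Right342At Blk348At)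
open Literature.MathematicalPhysics.QuantumFieldTheory.Balaban1983to89.B9Ineq349SiteThresholdRate (exists_threshold_349_rate)

noncomputable section

section Named

variable (d ℓ : ℕ) (hd : 1 ≤ d + 1) (hL : Odd (ℓ + 1) ∧ 1 < ℓ + 1) (b₀ b₁ : ℝ)

open Classical in
/-- ★ **THE `M`-THRESHOLD OF THE (3.49) FACT AT THE CLOSED RATE, NAMED**: the first witness of `exists_threshold_349_rate hδ₀ hδ₁` when `0 < δ₀ ∧ 0 < δ₁`, else `1`
(a total function of `d, ℓ, b₀, b₁, δ₀, δ₁`; opaque — use `fineEntryS_le_named`). [cite: Balaban1985BackgroundPropagators, (3.49) p.399; Balaban1984PropagatorsII, (2.59) p.233 («RM sufficiently large»), bookkeeping] -/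
def thrM349 (δ₀ δ₁ : ℝ) : ℝ :=
  if h : 0 < δ₀ ∧ 0 < δ₁ then
    (exists_threshold_349_rate (d := d) (ℓ := ℓ) (hd := hd) (hL := hL) (b₀ := b₀) (b₁ := b₁) h.1 h.2).choose
  else 1

open Classical in
/-- ★ **THE GEOMETRIC CONSTANT `C_g` OF THE (3.49) FACT AT THE CLOSED RATE, NAMED**: the second witness of `exists_threshold_349_rate hδ₀ hδ₁` when
`0 < δ₀ ∧ 0 < δ₁`, else `1` (opaque — use `fineEntryS_le_named`). [cite: Balaban1985BackgroundPropagators, (3.49) p.399 («O(1)»); Balaban1984PropagatorsII, Lemma 2.1 (2.60)–(2.63) p.234, bookkeeping] -/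
def cg349 (δ₀ δ₁ : ℝ) : ℝ :=
  if h : 0 < δ₀ ∧ 0 < δ₁ then
    (exists_threshold_349_rate (d := d) (ℓ := ℓ) (hd := hd) (hL := hL) (b₀ := b₀) (b₁ := b₁) h.1 h.2).choose_spec.choose
  else 1

variable {d ℓ hd hL b₀ b₁}

/-- `0 < thrM349 …` (both branches). [cite: Balaban1984PropagatorsII, (2.59) p.233, bookkeeping] -/
theorem thrM349_pos (δ₀ δ₁ : ℝ) : 0 < thrM349 d ℓ hd hL b₀ b₁ δ₀ δ₁ := by
  unfold thrM349
  split_ifs with h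
  · exact (exists_threshold_349_rate (d := d) (ℓ := ℓ) (hd := hd) (hL := hL) (b₀ := b₀) (b₁ := b₁) h.1 h.2).choose_spec.choose_spec.1
  · exact one_pos

/-- `0 < cg349 …` (both branches). [cite: Balaban1985BackgroundPropagators, (3.49) p.399, bookkeeping] -/
theorem cg349_pos (δ₀ δ₁ : ℝ) : 0 < cg349 d ℓ hd hL b₀ b₁ δ₀ δ₁ := by
  unfold cg349
  split_ifs with h
  · exact (exists_threshold_349_rate (d := d) (ℓ := ℓ) (hd := hd) (hL := hL) (b₀ := b₀) (b₁ := b₁) h.1 h.2).choose_spec.choose_spec.2.1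
  · exact one_pos

/-- ★★ **(3.49) AT ONE CONFIGURATION, EVERY MEMBER ABOVE THE NAMED THRESHOLD, WITH THE NAMED CONSTANT AND THE CLOSED RATE** — dag-n06-i's
`exists_threshold_349_rate` read at `thrM349 ∕ cg349`: for `0 < δ₀`, `0 < δ₁`, every index `i` with `thrM349 … δ₀ δ₁ ≤ L·M_h`, every fibre `𝔸`, all
`parS, Gp, U` and `B₀, B₁ ≥ 0`, `Left342At ∕ Right342At (B₀, δ₀)` and `Blk348At (B₁, δ₁)` imply
`fineEntryS i (P349Y i parS Gp) U y y′ n ≤ B₀B₁B₀·cg349 …·[1,(Lʲη)⁻¹,(Lʲη)⁻¹,(Lʲη)⁻²]ₙ·(L^{j′}η)^{−d′}·e^{−(min(δ₀,δ₁)∕8) d(y,y′)}`.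
[cite: Balaban1985BackgroundPropagators, (3.49) p.399 («using again Lemma 2.1»); Balaban1984PropagatorsII, Lemma 2.1 (2.60)–(2.63) p.234, (2.88) p.238] -/
theorem fineEntryS_le_named {δ₀ δ₁ : ℝ} (hδ₀ : 0 < δ₀) (hδ₁ : 0 < δ₁) (i : KIdx d ℓ hd hL b₀ b₁)
    (hM : thrM349 d ℓ hd hL b₀ b₁ δ₀ δ₁ ≤ ((ℓ : ℝ) + 1) * i.Mh)
    {𝔸 : Type} [NormedRing 𝔸] [NormedAlgebra ℂ 𝔸] [CompleteSpace 𝔸]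
    (parS : SiteParY 𝔸 i) (Gp : SiteOpY 𝔸 i) (U : CfgY 𝔸 i) {B₀ B₁ : ℝ} (hB₀ : 0 ≤ B₀) (hB₁ : 0 ≤ B₁)
    (hLe : Left342At i parS Gp U B₀ δ₀) (hRi : Right342At i parS Gp U B₀ δ₀) (hBk : Blk348At i parS Gp U B₁ δ₁)
    (n : Fin 4) (s s' : BlkY i) :
    fineEntryS i (P349Y i parS Gp) U s s' n ≤
      B₀ * B₁ * B₀ * cg349 d ℓ hd hL b₀ b₁ δ₀ δ₁ * B9.pref4inv (lenB i s) n * lenB i s' ^ (-((d + 1 : ℕ) : ℝ)) *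
        Real.exp (-(min δ₀ δ₁ / 8 * distB i s s')) := by
  have h : 0 < δ₀ ∧ 0 < δ₁ := ⟨hδ₀, hδ₁⟩
  have hM' : (exists_threshold_349_rate (d := d) (ℓ := ℓ) (hd := hd) (hL := hL) (b₀ := b₀) (b₁ := b₁) h.1 h.2).choose ≤ ((ℓ : ℝ) + 1) * i.Mh := by
    have e : thrM349 d ℓ hd hL b₀ b₁ δ₀ δ₁ = (exists_threshold_349_rate (d := d) (ℓ := ℓ) (hd := hd) (hL := hL) (b₀ := b₀) (b₁ := b₁) h.1 h.2).choose := by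
      unfold thrM349; rw [dif_pos h]
    exact e ▸ hM
  have e' : cg349 d ℓ hd hL b₀ b₁ δ₀ δ₁ = (exists_threshold_349_rate (d := d) (ℓ := ℓ) (hd := hd) (hL := hL) (b₀ := b₀) (b₁ := b₁) h.1 h.2).choose_spec.choose := by
    unfold cg349; rw [dif_pos h]
  rw [e']
  exact (exists_threshold_349_rate (d := d) (ℓ := ℓ) (hd := hd) (hL := hL) (b₀ := b₀) (b₁ := b₁) h.1 h.2).choose_spec.choose_spec.2.2 i hM' parS Gp U hB₀ hB₁
    hLe hRi hBk n s s'

end Named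

end

end Literature.MathematicalPhysics.QuantumFieldTheory.Balaban1983to89.B9Ineq349SiteThresholdRateNamed
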